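import Summits.QuantumFields.BalabanUV.Beta.EriceRemainderEnclosureHistoryAutonomyComparisonAgeCompositionAdaptiveFourAges

/-!
# EriceRemainderEnclosureHistoryAutonomyComparisonAgeCompositionTwoOldLevels — (E105e) route (N), first order: THE CENSUS YOUNG PART BELOW TWO CAPPED OLD
# LEVELS (parametric engines).  (E104) ran the old triple `{k₃,k₄,k₅}` as ONE capped cluster — the last step is cheap, but a wide triple has a weak cap
# (`0.81 … 0.96`) and the separation grows to `86 … 493`.  Splitting the triple into TWO levels (option B: `{k₃}` + the pair `{k₄,k₅}`; option C: the
# pair `{k₃,k₄}` + `{k₅}`) and running the ADAPTIVE engine (E101b) with overshoots `(1∕5, κ₁(q), 0)`, `κ₁(q) = 4hi₁X₂(q)∕(lo₂(1 − X₂(q)))` (the top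
# closure with equality, as in (E101e)), leaves ONE closure — the middle one — to certify on the load polytope `X₁ ≤ c₁`, `X₂ ≤ c₂`, `X₁ + X₂ ≤ V`
# (V = the triple cap of (E103)): a HYPOTHESIS `hcert` here, discharged per cell by the 1-dimensional tables of (E105a–d).  Two wrappers:
# **`flow_nonneg_young_pair_two_old_levels_of_cert`** (young pair `{1,k₂}`, `k₂ ≤ 29`, three levels) and **`flow_nonneg_far_two_old_levels_of_cert`**
# (`k₂ ≥ 30`: four levels `{1}, {k₂}, S₁, S₂` with `κ = (207∕500, 1∕5, κ₂(q), 0)` — the SAME certificate).  The cells and unions are the sequel (E105f).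

Cell `pub-balaban`, β-function sub-cell, BINDER row D4 «RemainderConst leaves for Bałaban's split» (`HOME/BINDER-OWNERS.md`; owner lineage `b2b-balaban-beta-an4`;
this file by co-owner #2 lineage `b2b-balaban-beta-d4-p2`, generation 89), β-FLOW TEAM duty (1), FREEZE (0) honoured (def-free; nothing restated).

HONEST FRAMING (page 1, verbatim and binding).  *"Discharging BetaPertH makes Bałaban's UV stability UNCONDITIONAL — a real constructive-QFT result; it is
NOT the continuum limit and NOT the Clay problem."*  THIS FILE DISCHARGES NOTHING OF THE KIND.  Elementary real algebra ∕ real analysis about ABSTRACT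
functionals on a box ]0,γ]^ℕ with displayed floors, profiles and signs, and the FIRST-ORDER renewal objects of route (N) built from them — hypotheses of a
census, not facts; the form, signs, ages and moments of Bałaban's (1.22) limit functional are NOT PRINTED ([I] p. 298; GAPS G-t4-U2-1∕-2) and NOT asserted.
Row D4 class UNCHANGED (critical-path width 0; instance 0∕1; D4 DISCHARGE NO DATE).  HONEST DEPENDENCY: continuum YM on T⁴ ⇐ BetaPertH ∧ nine spine
estimates (0/9 proved); BetaPertH ⇐ (D1) ∧ (D4) ∧ CAP+tail; G-an2-4 gates asym, D1 and NE2/3/4.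

THE POINT (README `HOME/b2b-balaban-beta-d4-p2/g89/README.md` §4).  Uses (E101b) `flow_nonneg_adaptive_cluster_levels`, (E97c) `young_pair_load_le`, (E94b) `load_le_of_sq` BY
NAME; the proofs are (E101e)'s and (E104e)'s with the two old levels as clusters.  NOT CLAIMED: the certificates (sequel); anything printed — NOT B12 Thm 2,
NOT BetaPertH, NOT continuum, NOT Clay.

WHAT IS PROVED ([folklore]; 0 `def`, 0 sorry).  §1 **`flow_nonneg_young_pair_two_old_levels_of_cert`**.  §2 **`flow_nonneg_far_two_old_levels_of_cert`**.
-/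
noncomputable section
open Finset

namespace Summit.QuantumFields.BalabanUV.Beta.EriceRemainderEnclosureHistoryAutonomyComparisonAgeCompositionTwoOldLevels

open Literature.MathematicalPhysics.QuantumFieldTheory.Balaban1983to89
open Literature.MathematicalPhysics.QuantumFieldTheory.Balaban1983to89.T4BetaStationary
open Literature.MathematicalPhysics.QuantumFieldTheory.Balaban1983to89.T4BetaFlowWellPosed
open Summit.QuantumFields.BalabanUV.Beta.EriceRemainderEnclosureHistoryAutonomyComparisonAgeCompositionYoungPairMoment (load_le_of_sq)
open Summit.QuantumFields.BalabanUV.Beta.EriceRemainderEnclosureHistoryAutonomyComparisonAgeCompositionYoungPairCapSeparatedAges (young_pair_load_le)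
open Summit.QuantumFields.BalabanUV.Beta.EriceRemainderEnclosureHistoryAutonomyComparisonAgeCompositionAdaptiveLevels (flow_nonneg_adaptive_cluster_levels)

variable {B : (ℕ → ℝ) → ℝ} {γ b gIR : ℝ} {L : ℕ → ℝ} {K : ℕ} {h g : ℕ → ℝ}

/-! ## §1 The census young pair below two capped old levels -/

/-- **THE CENSUS YOUNG PAIR BELOW TWO CAPPED OLD LEVELS (parametric).**  Young pair `{1,k₂}` (`2 ≤ k₂ ≤ 29`, cap `0.8333`), two older clusters `S₁ ⊂ [lo₁,hi₁]`,
`S₂ ⊂ [lo₂,hi₂]` with `k₂ < lo₁ ≤ hi₁ < lo₂ ≤ hi₂ < K`, caps `Σ_{S₁} x ≤ c₁`, `Σ_{S₂} x ≤ c₂ < 1`, joint `Σ_{S₁} x + Σ_{S₂} x ≤ V` at every pin, the profile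
vanishing off `{1,k₂} ∪ S₁ ∪ S₂`, and a CERTIFICATE of the middle closure on the load polytope: for all `X₁ ∈ [0,c₁]`, `X₂ ≤ c₂`, `X₁ + X₂ ≤ V`, `κ₁ ≥ 0` with
`κ₁·lo₂(1 − X₂) = 4hi₁X₂`: `X₁(1+κ₁) < 1` and `k₂(4X₁(1+κ₁) + κ₁) ≤ (1∕5)(1 − X₁(1+κ₁))·lo₁`.  THEN `0 ≤ ε ≤ e` at every pin ((E101b) with
`S = ({1,k₂}, S₁, S₂)`, `κ = (1∕5, κ₁(q), 0)`). [folklore] -/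
theorem flow_nonneg_young_pair_two_old_levels_of_cert
    (hmono : ∀ u v : ℕ → ℝ, SeqBox γ u → SeqBox γ v → (∀ j, u j ≤ v j) → B u ≤ B v)
    (hL : ∀ k, 0 ≤ L k) (hb : 0 < b) (hlo : ∀ u, SeqBox γ u → b ≤ B u) (hdom : ∀ u, SeqBox γ u → ∑ k ∈ range K, L k * u k ≤ B u)
    (hh : SeqBox γ h) (hf : MemFlow B gIR h) (hg : ∀ t, 0 < g t ∧ g t ≤ 1)
    (hgF : ∀ t, 1 ≤ g t * (1 + ∑ k ∈ range K, L k * h (t + k) ^ 3 / 2))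
    {k₂ : ℕ} (hk2 : 2 ≤ k₂) (hk29 : k₂ ≤ 29) {S₁ S₂ : Finset ℕ} {lo₁ hi₁ lo₂ hi₂ : ℕ}
    (hS₁ : ∀ k ∈ S₁, lo₁ ≤ k ∧ k ≤ hi₁) (hS₂ : ∀ k ∈ S₂, lo₂ ≤ k ∧ k ≤ hi₂) (h01 : k₂ < lo₁) (hlh₁ : lo₁ ≤ hi₁) (h12 : hi₁ < lo₂) (hlh₂ : lo₂ ≤ hi₂)
    (hhi2K : hi₂ < K) {c₁ c₂ V : ℝ} (hc2 : c₂ < 1)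
    (hX1c : ∀ q, ∑ k ∈ S₁, (k : ℝ) * (L k * h (q + k) ^ 3 / 2) ≤ c₁) (hX2c : ∀ q, ∑ k ∈ S₂, (k : ℝ) * (L k * h (q + k) ^ 3 / 2) ≤ c₂)
    (hjoint : ∀ q, ∑ k ∈ S₁, (k : ℝ) * (L k * h (q + k) ^ 3 / 2) + ∑ k ∈ S₂, (k : ℝ) * (L k * h (q + k) ^ 3 / 2) ≤ V)
    (hcert : ∀ X₁ X₂ κ₁ : ℝ, 0 ≤ X₁ → X₁ ≤ c₁ → X₂ ≤ c₂ → X₁ + X₂ ≤ V → 0 ≤ κ₁ → κ₁ * ((lo₂ : ℝ) * (1 - X₂)) = 4 * (hi₁ : ℝ) * X₂ →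
      X₁ * (1 + κ₁) < 1 ∧ (k₂ : ℝ) * (4 * X₁ * (1 + κ₁) + κ₁) ≤ 1 / 5 * (1 - X₁ * (1 + κ₁)) * (lo₁ : ℝ))
    (hLa : ∀ l, l < K → l ≠ 1 → l ≠ k₂ → l ∉ S₁ → l ∉ S₂ → L l = 0)
    {N : ℕ} {KL : ℕ → ℕ → ℕ → ℝ}
    (hKL : ∀ k n l, KL k n l = if 0 < k ∧ k < K ∧ l < k then L k * h (n + k) ^ 3 / 2 * ∏ t ∈ Ico (n + 1 + l) (n + k + 1), g t else 0)
    {KA : ℕ → ℕ → ℕ → ℝ} {RA : ℕ → (ℕ → ℝ) → ℕ → ℝ}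
    (hRA : ∀ i v m, RA i v m = ∑ l ∈ range K, KA i m l * v (m + 1 + l))
    (hKA : ∀ i m l, KA i m l = KL i m l + KA (i + 1) m l) (hKAtop : ∀ m l, KA K m l = 0)
    {e ε : ℕ → ℝ} (he0 : ∀ m, 0 ≤ e m) (hea : ∀ m, e (m + 1) ≤ e m)
    (hεt : ∀ m, N < m → ε m = 0) (hεrec : ∀ m, ε m = e m - RA 1 ε m) : ∀ m, 0 ≤ ε m ∧ ε m ≤ e m := by
  have hpos : ∀ n, 0 < h n := fun n => (hh n).1
  have hc0 : ∀ k q : ℕ, 0 ≤ (k : ℝ) * (L k * h (q + k) ^ 3 / 2) := fun k q => by have := hL k; have := hpos (q + k); positivity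
  have hlo2pos : (0 : ℝ) < lo₂ := by exact_mod_cast (show 0 < lo₂ by omega)
  obtain ⟨X₁, hX₁⟩ : ∃ X₁ : ℕ → ℝ, ∀ q, X₁ q = ∑ k ∈ S₁, (k : ℝ) * (L k * h (q + k) ^ 3 / 2) := ⟨_, fun _ => rfl⟩
  obtain ⟨X₂, hX₂⟩ : ∃ X₂ : ℕ → ℝ, ∀ q, X₂ q = ∑ k ∈ S₂, (k : ℝ) * (L k * h (q + k) ^ 3 / 2) := ⟨_, fun _ => rfl⟩
  have hX1n : ∀ q, 0 ≤ X₁ q := fun q => by rw [hX₁]; exact sum_nonneg fun k _ => hc0 k q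
  have hX2n : ∀ q, 0 ≤ X₂ q := fun q => by rw [hX₂]; exact sum_nonneg fun k _ => hc0 k q
  have hX2lt : ∀ q, X₂ q < 1 := fun q => by rw [hX₂]; exact lt_of_le_of_lt (hX2c q) hc2
  -- the levels and the overshoots
  obtain ⟨S, hS⟩ : ∃ S : ℕ → Finset ℕ, ∀ j, S j = if j = 0 then {1, k₂} else if j = 1 then S₁ else S₂ := ⟨_, fun _ => rfl⟩
  obtain ⟨LO, hLO⟩ : ∃ LO : ℕ → ℕ, ∀ j, LO j = if j = 0 then 1 else if j = 1 then lo₁ else lo₂ := ⟨_, fun _ => rfl⟩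
  obtain ⟨HI, hHI⟩ : ∃ HI : ℕ → ℕ, ∀ j, HI j = if j = 0 then k₂ else if j = 1 then hi₁ else hi₂ := ⟨_, fun _ => rfl⟩
  obtain ⟨κ, hκ⟩ : ∃ κ : ℕ → ℕ → ℝ, ∀ j q, κ j q = if j = 0 then 1 / 5 else if j = 1 then 4 * hi₁ * X₂ q / (lo₂ * (1 - X₂ q)) else 0 :=
    ⟨_, fun _ _ => rfl⟩
  have hS0 : S 0 = {1, k₂} := by rw [hS]; simp
  have hS1 : S 1 = S₁ := by rw [hS]; simp
  have hS2 : S 2 = S₂ := by rw [hS]; simp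
  have hLO0 : LO 0 = 1 := by rw [hLO]; simp
  have hLO1 : LO 1 = lo₁ := by rw [hLO]; simp
  have hLO2 : LO 2 = lo₂ := by rw [hLO]; simp
  have hHI0 : HI 0 = k₂ := by rw [hHI]; simp
  have hHI1 : HI 1 = hi₁ := by rw [hHI]; simp
  have hHI2 : HI 2 = hi₂ := by rw [hHI]; simp
  have hκ0v : ∀ q, κ 0 q = 1 / 5 := fun q => by rw [hκ]; simp
  have hκ1v : ∀ q, κ 1 q = 4 * hi₁ * X₂ q / (lo₂ * (1 - X₂ q)) := fun q => by rw [hκ]; simp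
  have hκ2v : ∀ q, κ 2 q = 0 := fun q => by rw [hκ]; simp
  have hden : ∀ q, 0 < (lo₂ : ℝ) * (1 - X₂ q) := fun q => mul_pos hlo2pos (by linarith [hX2lt q])
  have hκ1nn' : ∀ q, 0 ≤ κ 1 q := fun q => by
    rw [hκ1v]; exact div_nonneg (by have := hX2n q; positivity) (hden q).le
  have hκeq : ∀ q, κ 1 q * ((lo₂ : ℝ) * (1 - X₂ q)) = 4 * (hi₁ : ℝ) * X₂ q := fun q => by
    rw [hκ1v, div_mul_cancel₀ _ (ne_of_gt (hden q))]
  -- members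
  have hmem : ∀ j, j < 3 → ∀ k ∈ S j, 1 ≤ k ∧ k < K ∧ LO j ≤ k ∧ k ≤ HI j := by
    intro j hj k hk
    interval_cases j
    · rw [hS0, mem_insert, mem_singleton] at hk; rw [hLO0, hHI0]; rcases hk with rfl | rfl <;> omega
    · rw [hS1] at hk; rw [hLO1, hHI1]; have := hS₁ k hk; omega
    · rw [hS2] at hk; rw [hLO2, hHI2]; have := hS₂ k hk; omega
  refine flow_nonneg_adaptive_cluster_levels hmono hL hb hlo hdom hh hf hg hgF (by omega) (r := 3) (S := S) (lo := LO) (hi := HI) (κ := κ)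
    (fun j q => ?_) (fun j hj k hk => ⟨(hmem j hj k hk).1, (hmem j hj k hk).2.1⟩) (fun j hj k hk => (hmem j hj k hk).2.2.1)
    (fun j hj k hk => (hmem j hj k hk).2.2.2) (fun j hj1 hjr => ?_) (fun j hj1 hjr => ?_)
    (fun j hj => ?_) (fun i j hij hjr => ?_) (fun l hl hno => ?_) (fun q => ?_) (fun j q hj1 hjr => ?_) hKL hRA hKA hKAtop he0 hea hεt hεrec
  · rcases Nat.lt_or_ge j 3 with hj | hj
    · interval_cases j
      · rw [hκ0v]; norm_num
      · exact hκ1nn' q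
      · rw [hκ2v]
    · rw [hκ, if_neg (by omega), if_neg (by omega)]
  · have : j = 1 ∨ j = 2 := by omega
    rcases this with rfl | rfl
    · rw [hLO1, hHI1]; exact hlh₁
    · rw [hLO2, hHI2]; exact hlh₂
  · have : j = 1 ∨ j = 2 := by omega
    rcases this with rfl | rfl
    · rw [hLO1]; omega
    · rw [hLO2]; omega
  · have : j = 0 ∨ j = 1 := by omega
    rcases this with rfl | rfl
    · rw [hHI0, hLO1]; omega
    · rw [hHI1, hLO2]; omega
  · exact disjoint_left.mpr fun x hx hx' => by
      have h1 := (hmem i (by omega) x hx).2.2.2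
      have h2 := (hmem j hjr x hx').2.2.1
      have : (i = 0 ∧ j = 1) ∨ (i = 0 ∧ j = 2) ∨ (i = 1 ∧ j = 2) := by omega
      rcases this with ⟨rfl, rfl⟩ | ⟨rfl, rfl⟩ | ⟨rfl, rfl⟩
      · rw [hHI0] at h1; rw [hLO1] at h2; omega
      · rw [hHI0] at h1; rw [hLO2] at h2; omega
      · rw [hHI1] at h1; rw [hLO2] at h2; omega
  · have h0 := hno 0 (by omega); have h1 := hno 1 (by omega); have h2 := hno 2 (by omega)
    rw [hS0, mem_insert, mem_singleton, not_or] at h0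
    rw [hS1] at h1
    rw [hS2] at h2
    exact hLa l hl h0.1 h0.2 h1 h2
  · -- the young pair's closure: 0.8333·(1 + 1∕5) ≤ 1
    rw [hS0, hκ0v, sum_pair (show (1 : ℕ) ≠ k₂ by omega), Nat.cast_one, one_mul]
    have := young_pair_load_le hmono hL hb hlo hdom hh hf hk2 hk29 (by omega) q
    nlinarith
  · have : j = 1 ∨ j = 2 := by omega
    rcases this with rfl | rfl
    · -- THE MIDDLE CLOSURE: the certificate on the load polytope
      rw [hS1, show (1 : ℕ) - 1 = 0 from rfl, hHI0, hLO1, hκ0v, ← hX₁]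
      exact hcert (X₁ q) (X₂ q) (κ 1 q) (hX1n q) (by rw [hX₁]; exact hX1c q) (by rw [hX₂]; exact hX2c q)
        (by rw [hX₁, hX₂]; exact hjoint q) (hκ1nn' q) (hκeq q)
    · -- the top closure: equality by the choice of κ₁
      rw [hS2, show (2 : ℕ) - 1 = 1 from rfl, hHI1, hLO2, hκ2v, ← hX₂]
      refine ⟨by linarith [hX2lt q], ?_⟩
      have e1 : κ 1 q * (1 - X₂ q * (1 + 0)) * (lo₂ : ℝ) = κ 1 q * ((lo₂ : ℝ) * (1 - X₂ q)) := by ring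
      rw [e1, hκeq q]
      apply le_of_eq; ring

/-! ## §2 The far young part (`k₂ ≥ 30`) below two capped old levels -/

/-- **THE FAR YOUNG PART BELOW TWO CAPPED OLD LEVELS (parametric, `k₂ ≥ 30`).**  As §1 with FOUR levels `{1}`, `{k₂}`, `S₁`, `S₂` and
`κ = (207∕500, 1∕5, κ₂(q), 0)`: the young age's closure `0.7072·(1 + 207∕500) ≤ 1`, the second `4X(6∕5) + 1∕5 ≤ (207∕500)(1 − (6∕5)X)·k₂` (`X = x_{k₂} ≤ 0.616`,
`k₂ ≥ 30`), the third by the SAME certificate `hcert`, the top with equality. [folklore] -/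
theorem flow_nonneg_far_two_old_levels_of_cert
    (hmono : ∀ u v : ℕ → ℝ, SeqBox γ u → SeqBox γ v → (∀ j, u j ≤ v j) → B u ≤ B v)
    (hL : ∀ k, 0 ≤ L k) (hb : 0 < b) (hlo : ∀ u, SeqBox γ u → b ≤ B u) (hdom : ∀ u, SeqBox γ u → ∑ k ∈ range K, L k * u k ≤ B u)
    (hh : SeqBox γ h) (hf : MemFlow B gIR h) (hg : ∀ t, 0 < g t ∧ g t ≤ 1)
    (hgF : ∀ t, 1 ≤ g t * (1 + ∑ k ∈ range K, L k * h (t + k) ^ 3 / 2))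
    {k₂ : ℕ} (hk2 : 30 ≤ k₂) {S₁ S₂ : Finset ℕ} {lo₁ hi₁ lo₂ hi₂ : ℕ}
    (hS₁ : ∀ k ∈ S₁, lo₁ ≤ k ∧ k ≤ hi₁) (hS₂ : ∀ k ∈ S₂, lo₂ ≤ k ∧ k ≤ hi₂) (h01 : k₂ < lo₁) (hlh₁ : lo₁ ≤ hi₁) (h12 : hi₁ < lo₂) (hlh₂ : lo₂ ≤ hi₂)
    (hhi2K : hi₂ < K) {c₁ c₂ V : ℝ} (hc2 : c₂ < 1)
    (hX1c : ∀ q, ∑ k ∈ S₁, (k : ℝ) * (L k * h (q + k) ^ 3 / 2) ≤ c₁) (hX2c : ∀ q, ∑ k ∈ S₂, (k : ℝ) * (L k * h (q + k) ^ 3 / 2) ≤ c₂)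
    (hjoint : ∀ q, ∑ k ∈ S₁, (k : ℝ) * (L k * h (q + k) ^ 3 / 2) + ∑ k ∈ S₂, (k : ℝ) * (L k * h (q + k) ^ 3 / 2) ≤ V)
    (hcert : ∀ X₁ X₂ κ₁ : ℝ, 0 ≤ X₁ → X₁ ≤ c₁ → X₂ ≤ c₂ → X₁ + X₂ ≤ V → 0 ≤ κ₁ → κ₁ * ((lo₂ : ℝ) * (1 - X₂)) = 4 * (hi₁ : ℝ) * X₂ →
      X₁ * (1 + κ₁) < 1 ∧ (k₂ : ℝ) * (4 * X₁ * (1 + κ₁) + κ₁) ≤ 1 / 5 * (1 - X₁ * (1 + κ₁)) * (lo₁ : ℝ))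
    (hLa : ∀ l, l < K → l ≠ 1 → l ≠ k₂ → l ∉ S₁ → l ∉ S₂ → L l = 0)
    {N : ℕ} {KL : ℕ → ℕ → ℕ → ℝ}
    (hKL : ∀ k n l, KL k n l = if 0 < k ∧ k < K ∧ l < k then L k * h (n + k) ^ 3 / 2 * ∏ t ∈ Ico (n + 1 + l) (n + k + 1), g t else 0)
    {KA : ℕ → ℕ → ℕ → ℝ} {RA : ℕ → (ℕ → ℝ) → ℕ → ℝ}
    (hRA : ∀ i v m, RA i v m = ∑ l ∈ range K, KA i m l * v (m + 1 + l))
    (hKA : ∀ i m l, KA i m l = KL i m l + KA (i + 1) m l) (hKAtop : ∀ m l, KA K m l = 0)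
    {e ε : ℕ → ℝ} (he0 : ∀ m, 0 ≤ e m) (hea : ∀ m, e (m + 1) ≤ e m)
    (hεt : ∀ m, N < m → ε m = 0) (hεrec : ∀ m, ε m = e m - RA 1 ε m) : ∀ m, 0 ≤ ε m ∧ ε m ≤ e m := by
  have hpos : ∀ n, 0 < h n := fun n => (hh n).1
  have hc0 : ∀ k q : ℕ, 0 ≤ (k : ℝ) * (L k * h (q + k) ^ 3 / 2) := fun k q => by have := hL k; have := hpos (q + k); positivity
  have hk2r : (30 : ℝ) ≤ k₂ := by exact_mod_cast hk2
  have hlo2pos : (0 : ℝ) < lo₂ := by exact_mod_cast (show 0 < lo₂ by omega)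
  obtain ⟨X₀, hX₀⟩ : ∃ X₀ : ℕ → ℝ, ∀ q, X₀ q = L 1 * h (q + 1) ^ 3 / 2 := ⟨_, fun _ => rfl⟩
  obtain ⟨Xm, hXm⟩ : ∃ Xm : ℕ → ℝ, ∀ q, Xm q = (k₂ : ℝ) * (L k₂ * h (q + k₂) ^ 3 / 2) := ⟨_, fun _ => rfl⟩
  obtain ⟨X₁, hX₁⟩ : ∃ X₁ : ℕ → ℝ, ∀ q, X₁ q = ∑ k ∈ S₁, (k : ℝ) * (L k * h (q + k) ^ 3 / 2) := ⟨_, fun _ => rfl⟩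
  obtain ⟨X₂, hX₂⟩ : ∃ X₂ : ℕ → ℝ, ∀ q, X₂ q = ∑ k ∈ S₂, (k : ℝ) * (L k * h (q + k) ^ 3 / 2) := ⟨_, fun _ => rfl⟩
  have hX0c : ∀ q, X₀ q ≤ 7072 / 10000 := fun q => by
    rw [hX₀]
    have := load_le_of_sq hmono hL hb hlo hdom hh hf (k := 1) le_rfl (by omega) (so := 7072 / 10000) (by norm_num) (by norm_num) q
    simpa using this
  have hXmc : ∀ q, 0 ≤ Xm q ∧ Xm q ≤ 77 / 125 := fun q => by
    refine ⟨by rw [hXm]; exact hc0 k₂ q, ?_⟩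
    rw [hXm]; exact load_le_of_sq hmono hL hb hlo hdom hh hf (by omega) (by omega) (so := 77 / 125) (by norm_num) (by nlinarith) q
  have hX1n : ∀ q, 0 ≤ X₁ q := fun q => by rw [hX₁]; exact sum_nonneg fun k _ => hc0 k q
  have hX2n : ∀ q, 0 ≤ X₂ q := fun q => by rw [hX₂]; exact sum_nonneg fun k _ => hc0 k q
  have hX2lt : ∀ q, X₂ q < 1 := fun q => by rw [hX₂]; exact lt_of_le_of_lt (hX2c q) hc2
  obtain ⟨S, hS⟩ : ∃ S : ℕ → Finset ℕ, ∀ j, S j = if j = 0 then {1} else if j = 1 then {k₂} else if j = 2 then S₁ else S₂ := ⟨_, fun _ => rfl⟩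
  obtain ⟨LO, hLO⟩ : ∃ LO : ℕ → ℕ, ∀ j, LO j = if j = 0 then 1 else if j = 1 then k₂ else if j = 2 then lo₁ else lo₂ := ⟨_, fun _ => rfl⟩
  obtain ⟨HI, hHI⟩ : ∃ HI : ℕ → ℕ, ∀ j, HI j = if j = 0 then 1 else if j = 1 then k₂ else if j = 2 then hi₁ else hi₂ := ⟨_, fun _ => rfl⟩
  obtain ⟨κ, hκ⟩ : ∃ κ : ℕ → ℕ → ℝ, ∀ j q, κ j q =
      if j = 0 then 207 / 500 else if j = 1 then 1 / 5 else if j = 2 then 4 * hi₁ * X₂ q / (lo₂ * (1 - X₂ q)) else 0 := ⟨_, fun _ _ => rfl⟩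
  have hS0 : S 0 = {1} := by rw [hS]; simp
  have hS1 : S 1 = {k₂} := by rw [hS]; simp
  have hS2 : S 2 = S₁ := by rw [hS]; simp
  have hS3 : S 3 = S₂ := by rw [hS]; simp
  have hLO0 : LO 0 = 1 := by rw [hLO]; simp
  have hLO1 : LO 1 = k₂ := by rw [hLO]; simp
  have hLO2 : LO 2 = lo₁ := by rw [hLO]; simp
  have hLO3 : LO 3 = lo₂ := by rw [hLO]; simp
  have hHI0 : HI 0 = 1 := by rw [hHI]; simp
  have hHI1 : HI 1 = k₂ := by rw [hHI]; simp
  have hHI2 : HI 2 = hi₁ := by rw [hHI]; simp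
  have hHI3 : HI 3 = hi₂ := by rw [hHI]; simp
  have hκ0v : ∀ q, κ 0 q = 207 / 500 := fun q => by rw [hκ]; simp
  have hκ1v : ∀ q, κ 1 q = 1 / 5 := fun q => by rw [hκ]; simp
  have hκ2v : ∀ q, κ 2 q = 4 * hi₁ * X₂ q / (lo₂ * (1 - X₂ q)) := fun q => by rw [hκ]; simp
  have hκ3v : ∀ q, κ 3 q = 0 := fun q => by rw [hκ]; simp
  have hden : ∀ q, 0 < (lo₂ : ℝ) * (1 - X₂ q) := fun q => mul_pos hlo2pos (by linarith [hX2lt q])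
  have hκ2nn' : ∀ q, 0 ≤ κ 2 q := fun q => by
    rw [hκ2v]; exact div_nonneg (by have := hX2n q; positivity) (hden q).le
  have hκeq : ∀ q, κ 2 q * ((lo₂ : ℝ) * (1 - X₂ q)) = 4 * (hi₁ : ℝ) * X₂ q := fun q => by
    rw [hκ2v, div_mul_cancel₀ _ (ne_of_gt (hden q))]
  have hmem : ∀ j, j < 4 → ∀ k ∈ S j, 1 ≤ k ∧ k < K ∧ LO j ≤ k ∧ k ≤ HI j := by
    intro j hj k hk
    interval_cases j
    · rw [hS0, mem_singleton] at hk; rw [hLO0, hHI0]; omega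
    · rw [hS1, mem_singleton] at hk; rw [hLO1, hHI1]; omega
    · rw [hS2] at hk; rw [hLO2, hHI2]; have := hS₁ k hk; omega
    · rw [hS3] at hk; rw [hLO3, hHI3]; have := hS₂ k hk; omega
  refine flow_nonneg_adaptive_cluster_levels hmono hL hb hlo hdom hh hf hg hgF (by omega) (r := 4) (S := S) (lo := LO) (hi := HI) (κ := κ)
    (fun j q => ?_) (fun j hj k hk => ⟨(hmem j hj k hk).1, (hmem j hj k hk).2.1⟩) (fun j hj k hk => (hmem j hj k hk).2.2.1)
    (fun j hj k hk => (hmem j hj k hk).2.2.2) (fun j hj1 hjr => ?_) (fun j hj1 hjr => ?_)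
    (fun j hj => ?_) (fun i j hij hjr => ?_) (fun l hl hno => ?_) (fun q => ?_) (fun j q hj1 hjr => ?_) hKL hRA hKA hKAtop he0 hea hεt hεrec
  · rcases Nat.lt_or_ge j 4 with hj | hj
    · interval_cases j
      · rw [hκ0v]; norm_num
      · rw [hκ1v]; norm_num
      · exact hκ2nn' q
      · rw [hκ3v]
    · rw [hκ, if_neg (by omega), if_neg (by omega), if_neg (by omega)]
  · have : j = 1 ∨ j = 2 ∨ j = 3 := by omega
    rcases this with rfl | rfl | rfl
    · rw [hLO1, hHI1]
    · rw [hLO2, hHI2]; exact hlh₁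
    · rw [hLO3, hHI3]; exact hlh₂
  · have : j = 1 ∨ j = 2 ∨ j = 3 := by omega
    rcases this with rfl | rfl | rfl
    · rw [hLO1]; omega
    · rw [hLO2]; omega
    · rw [hLO3]; omega
  · have : j = 0 ∨ j = 1 ∨ j = 2 := by omega
    rcases this with rfl | rfl | rfl
    · rw [hHI0, hLO1]; omega
    · rw [hHI1, hLO2]; omega
    · rw [hHI2, hLO3]; omega
  · exact disjoint_left.mpr fun x hx hx' => by
      have h1 := (hmem i (by omega) x hx).2.2.2
      have h2 := (hmem j hjr x hx').2.2.1
      have : (i = 0 ∧ j = 1) ∨ (i = 0 ∧ j = 2) ∨ (i = 0 ∧ j = 3) ∨ (i = 1 ∧ j = 2) ∨ (i = 1 ∧ j = 3) ∨ (i = 2 ∧ j = 3) := by omega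
      rcases this with ⟨rfl, rfl⟩ | ⟨rfl, rfl⟩ | ⟨rfl, rfl⟩ | ⟨rfl, rfl⟩ | ⟨rfl, rfl⟩ | ⟨rfl, rfl⟩
      · rw [hHI0] at h1; rw [hLO1] at h2; omega
      · rw [hHI0] at h1; rw [hLO2] at h2; omega
      · rw [hHI0] at h1; rw [hLO3] at h2; omega
      · rw [hHI1] at h1; rw [hLO2] at h2; omega
      · rw [hHI1] at h1; rw [hLO3] at h2; omega
      · rw [hHI2] at h1; rw [hLO3] at h2; omega
  · have h0 := hno 0 (by omega); have h1 := hno 1 (by omega); have h2 := hno 2 (by omega); have h3 := hno 3 (by omega)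
    rw [hS0, mem_singleton] at h0
    rw [hS1, mem_singleton] at h1
    rw [hS2] at h2
    rw [hS3] at h3
    exact hLa l hl h0 h1 h2 h3
  · rw [hS0, hκ0v, sum_singleton, Nat.cast_one, one_mul]
    have := hX0c q; rw [hX₀] at this
    nlinarith [this]
  · have : j = 1 ∨ j = 2 ∨ j = 3 := by omega
    rcases this with rfl | rfl | rfl
    · -- {k₂}: 4X(6∕5) + 1∕5 ≤ (207∕500)(1 − (6∕5)X)·k₂
      rw [hS1, sum_singleton, show (1 : ℕ) - 1 = 0 from rfl, hHI0, hLO1, hκ0v, hκ1v, ← hXm, Nat.cast_one, one_mul]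
      have h1c := hXmc q
      refine ⟨by nlinarith [h1c.2], ?_⟩
      have hp := mul_le_mul hk2r (show (163 : ℝ) / 625 ≤ 1 - Xm q * (1 + 1 / 5) by linarith [h1c.2]) (by norm_num) (Nat.cast_nonneg k₂)
      linarith [hp, h1c.1, h1c.2]
    · -- S₁: the certificate
      rw [hS2, show (2 : ℕ) - 1 = 1 from rfl, hHI1, hLO2, hκ1v, ← hX₁]
      exact hcert (X₁ q) (X₂ q) (κ 2 q) (hX1n q) (by rw [hX₁]; exact hX1c q) (by rw [hX₂]; exact hX2c q)
        (by rw [hX₁, hX₂]; exact hjoint q) (hκ2nn' q) (hκeq q)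
    · -- S₂: the top closure, equality
      rw [hS3, show (3 : ℕ) - 1 = 2 from rfl, hHI2, hLO3, hκ3v, ← hX₂]
      refine ⟨by linarith [hX2lt q], ?_⟩
      have e1 : κ 2 q * (1 - X₂ q * (1 + 0)) * (lo₂ : ℝ) = κ 2 q * ((lo₂ : ℝ) * (1 - X₂ q)) := by ring
      rw [e1, hκeq q]
      apply le_of_eq; ring

end Summit.QuantumFields.BalabanUV.Beta.EriceRemainderEnclosureHistoryAutonomyComparisonAgeCompositionTwoOldLevels
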